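import Summits.AtomisticToContinuum.HydrodynamicLimit.Theorems.CollisionIsometryCLTDiffuseBackwardInfluenceOnePathBound
import Summits.AtomisticToContinuum.HydrodynamicLimit.Theorems.CollisionIsometryCLTDiffuseBackwardInfluenceRowBudgetN
import Summits.AtomisticToContinuum.HydrodynamicLimit.Theorems.CollisionIsometryCLTDiffuseBackwardInfluenceEntropyTransfer
import Summits.AtomisticToContinuum.HydrodynamicLimit.Theorems.CollisionIsometryCLTDiffuseBackwardInfluenceFewIdleSuperExp
import Summits.AtomisticToContinuum.HydrodynamicLimit.Theorems.CollisionIsometryCLTDiffuseBackwardInfluenceOneFlightShareLD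
import Summits.AtomisticToContinuum.HydrodynamicLimit.Theorems.CollisionIsometryCLTDiffuseBackwardInfluenceTubeLD
import Summits.AtomisticToContinuum.HydrodynamicLimit.Theorems.CollisionIsometryCLTDiffuseBackwardInfluenceStubStickLD
import Literature.MathematicalPhysics.KineticTheory.HardSphereEulerProofs
import Literature.Analysis.FluidPDE.HardSphereFlowMeasurable
import HarnessLib
import Summits.AtomisticToContinuum.HydrodynamicLimit.Theorems.CollisionIsometryCLTDiffuseBackwardInfluencePairDefs
import Summits.AtomisticToContinuum.HydrodynamicLimit.Theorems.CollisionIsometryCLTDiffuseBackwardInfluencePairDelayedDefs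


namespace Summit.AtomisticToContinuum.HydrodynamicLimit.Theorems.DiffuseBackwardInfluenceShare

open scoped BigOperators Topology ENNReal InnerProductSpace Classical
open Filter Set MeasureTheory
open Literature.Analysis.FluidPDE (Config HardSphereFlow collidePair)
open Literature.MathematicalPhysics.KineticTheory (localGibbsLaw hsDiameter isProbabilityMeasure_localGibbsLaw)
open Summit.AtomisticToContinuum.HydrodynamicLimit.Theorems.DiffuseBackwardInfluenceNeg

noncomputable section

/-!
# The v8 COMPOSITION of the crux `DiffuseBackwardInfluence` (line `share-nondegeneracy-one-flight`, pair/tagged-deficit form)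
(stmt-AtomisticToContinuum-12950, route `CollisionIsometryCLT`; registered stub `stub_cruxCompositionT`; `--supports` file)

Kernel-checked glue of skeleton v8: the crux conclusion `CruxConclusionAt σ a₀ θ₀ u₀ Φ` for all small `σ` follows from
  * the pathwise pair-path bound with tagged deficit `PairPathBoundT σ` (…PairDelayedDefs), given the row budget `RowBudgetN σ`;
  * measurability of the delayed re-merge fraction `DelayedRemMeasurable σ` (`σ < 1/2`);
  * the lever `ShareLD.NearSetLD` below a density threshold (through `shareLDAt_of_nearSetLD`);
  * the two conjecture-level two-body inputs `PairPath.RemergeBounded` and `DelayedRemergeRare`;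
together with the landed inputs `stub_rowBudgetN`, `fewIdleSuperExp_of_tubeLD ∘ tubeLD_of_stickLD ∘ stub_stickLD` and
`stub_entropyTransfer`, which are imported.  The proof follows `cruxConclusion_of_statements` (…Conditional.lean): given the target
`e`, fix `M` from `RemergeBoundedAt` and the Markov level `j₀` with `9M/j₀ ≤ e/6`; the per-slot LD level `δ := e/216`, transfer rate
`C+2`, stub rate `C+3`; `η` from `ShareLDAt`; the contraction ratio `ρ := 1 − η(1−η)`; the depth `m ≥ j₀` with
`9·2^{j₀}ρ^{m−j₀} ≤ e/6` and `9(4M+2)/m ≤ e/6`; the grid `S := 2m` (`L = 1`); the bad event `B_N` (some slot has idle fraction or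
degeneracy score `≥ δ`) has `G_N(B_N) ≤ e^{-(C+2)(N+1)}` eventually (union bound over the `2S` per-slot events, `pair_union_rate_le`),
hence evolved-law mass `≤ e/54` by the entropy transfer; off `B_N` the pathwise bound is integrated term by term (constant,
`totalRemFr`, `delayedRemFr`, indicator), each contributing `≤ e/6`.  Nothing here is asserted without proof.
-/

/-- Arithmetic of the union bound: `2S·e^{−(C+3)n} ≤ e^{−(C+2)n}` as soon as `2S ≤ n` (private copy of `union_rate_le`). -/
private theorem pair_union_rate_le {S : ℕ} {C n : ℝ} (hn : (2 * S : ℝ) ≤ n) :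
    2 * (S : ℝ) * Real.exp (-((C + 3) * n)) ≤ Real.exp (-((C + 2) * n)) := by
  have hkey : Real.exp (-((C + 3) * n)) = Real.exp (-((C + 2) * n)) * Real.exp (-n) := by
    rw [← Real.exp_add]; congr 1; ring
  rw [hkey]
  have h1 : 2 * (S : ℝ) * Real.exp (-n) ≤ 1 := by
    have he : n + 1 ≤ Real.exp n := Real.add_one_le_exp n
    have hpos : 0 < Real.exp n := Real.exp_pos n
    rw [Real.exp_neg, ← div_eq_mul_inv, div_le_one hpos]
    linarith
  have hpos := Real.exp_pos (-((C + 2) * n))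
  calc 2 * (S : ℝ) * (Real.exp (-((C + 2) * n)) * Real.exp (-n))
      = Real.exp (-((C + 2) * n)) * (2 * (S : ℝ) * Real.exp (-n)) := by ring
    _ ≤ Real.exp (-((C + 2) * n)) * 1 := by gcongr
    _ = Real.exp (-((C + 2) * n)) := mul_one _

/-- COMPOSITION OF SKELETON v8 (kernel-checked, no sorry once proved): the stub STATEMENTS imply the crux's conclusion for `σ`
below `σ₀ := min (1/2, σ₃, σ₄(profiles), σₑ(profiles))`. [folklore] -/
theorem cruxConclusion_pair
    (h₀ : ∀ σ : ℝ, RowBudgetN σ)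
    (h₁ : ∀ σ : ℝ, RowBudgetN σ → PairPathBoundT σ)
    (h₂ : ∀ σ θ : ℝ, 0 < σ → σ < 1 / 2 → 0 < θ → ∀ Φ : (N : ℕ) → Flow σ N, FewIdleSuperExpAt σ θ Φ)
    (h₃ : ∃ σ₀ : ℝ, 0 < σ₀ ∧ ∀ σ : ℝ, 0 < σ → σ < σ₀ → ∀ θ : ℝ, 0 < θ → ∀ δ h : ℝ, 0 < δ → 0 < h →
      ∃ η₀ : ℝ, 0 < η₀ ∧ ∀ η : ℝ, 0 < η → η < η₀ → ∀ Φ : (N : ℕ) → Flow σ N, ShareLDAt σ θ δ h η Φ)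
    (h₄ : ∀ (a₀ θ₀ : T3 → ℝ) (u₀ : T3 → V3), Continuous a₀ → Continuous θ₀ → Continuous u₀ →
      (∀ x, 0 < a₀ x) → (∀ x, 0 < θ₀ x) → ∃ σ₀ : ℝ, 0 < σ₀ ∧ ∀ σ : ℝ, 0 < σ → σ < σ₀ →
      ∀ Φ : (N : ℕ) → Flow σ N, RemergeBoundedAt σ a₀ θ₀ u₀ Φ ∧ DelayedRemergeRareAt σ a₀ θ₀ u₀ Φ)
    (h₅ : ∀ (a₀ θ₀ : T3 → ℝ) (u₀ : T3 → V3), Continuous a₀ → Continuous θ₀ → Continuous u₀ →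
      (∀ x, 0 < a₀ x) → (∀ x, 0 < θ₀ x) → ∃ σₑ : ℝ, 0 < σₑ ∧ ∀ σ : ℝ, 0 < σ → σ < σₑ →
      ∃ θ : ℝ, 0 < θ ∧ ∃ C : ℝ, 0 ≤ C ∧ EntropyTransferAt σ θ C a₀ θ₀ u₀)
    (h₆ : ∀ σ : ℝ, σ < 1 / 2 → DelayedRemMeasurable σ)
    (a₀ θ₀ : T3 → ℝ) (u₀ : T3 → V3) (ha : Continuous a₀) (hθ : Continuous θ₀) (hu : Continuous u₀)
    (ha0 : ∀ x, 0 < a₀ x) (hθ0 : ∀ x, 0 < θ₀ x) :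
    ∃ σ₀ : ℝ, 0 < σ₀ ∧ ∀ σ : ℝ, 0 < σ → σ < σ₀ →
      ∀ Φ : (N : ℕ) → Flow σ N, CruxConclusionAt σ a₀ θ₀ u₀ Φ := by
  obtain ⟨σ₃, hσ₃, H3⟩ := h₃
  obtain ⟨σ₄, hσ₄, H4⟩ := h₄ a₀ θ₀ u₀ ha hθ hu ha0 hθ0
  obtain ⟨σₑ, hσₑ, H5⟩ := h₅ a₀ θ₀ u₀ ha hθ hu ha0 hθ0
  refine ⟨min (1 / 2) (min σ₃ (min σ₄ σₑ)), lt_min (by norm_num) (lt_min hσ₃ (lt_min hσ₄ hσₑ)), ?_⟩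
  intro σ hσ hσlt Φ Δ hΔp hΔ0 hΔg t ht
  have hσ2 : σ < 1 / 2 := lt_of_lt_of_le hσlt (min_le_left _ _)
  have hσ3 : σ < σ₃ := lt_of_lt_of_le hσlt ((min_le_right _ _).trans (min_le_left _ _))
  have hσ4 : σ < σ₄ :=
    lt_of_lt_of_le hσlt ((min_le_right _ _).trans ((min_le_right _ _).trans (min_le_left _ _)))
  have hσe : σ < σₑ :=
    lt_of_lt_of_le hσlt ((min_le_right _ _).trans ((min_le_right _ _).trans (min_le_right _ _)))
  obtain ⟨θ, hθpos, C, hC0, HT⟩ := H5 σ hσ hσe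
  have H1 : PairPathBoundT σ := h₁ σ (h₀ σ)
  have H2 : FewIdleSuperExpAt σ θ Φ := h₂ σ θ hσ hσ2 hθpos Φ
  have H4R : RemergeBoundedAt σ a₀ θ₀ u₀ Φ := (H4 σ hσ hσ4 Φ).1
  have H4D : DelayedRemergeRareAt σ a₀ θ₀ u₀ Φ := (H4 σ hσ hσ4 Φ).2
  have H6 : DelayedRemMeasurable σ := h₆ σ hσ2
  -- the local Gibbs laws are probability measures (σ ≤ 1/2)
  have hP : ∀ N, IsProbabilityMeasure (localGibbsLaw σ a₀ u₀ θ₀ N (Φ N)) := fun N =>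
    isProbabilityMeasure_localGibbsLaw ha hθ hu ha0 hθ0 hσ2.le N (Φ N)
  rw [ENNReal.tendsto_nhds_zero]
  intro ε hε
  by_cases hεtop : ε = ⊤
  · exact Eventually.of_forall fun N => hεtop ▸ le_top
  -- work with the real target `e`
  set e : ℝ := ε.toReal with he_def
  have he : 0 < e := ENNReal.toReal_pos hε.ne' hεtop
  have hεe : ENNReal.ofReal e = ε := ENNReal.ofReal_toReal hεtop
  -- re-merges bounded in mean: fix `M`, then the Markov level `j₀`
  obtain ⟨M, hM0, hM⟩ := H4R Δ hΔp hΔ0 hΔg t ht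
  obtain ⟨j₀, hj1, hj⟩ : ∃ j₀ : ℕ, 1 ≤ j₀ ∧ 9 * (M * (1 / (j₀ : ℝ))) ≤ e / 6 := by
    obtain ⟨k, hk⟩ := exists_nat_ge (54 * M / e)
    refine ⟨k + 1, Nat.le_add_left 1 k, ?_⟩
    have hk1 : (0 : ℝ) < ((k + 1 : ℕ) : ℝ) := by exact_mod_cast Nat.succ_pos k
    have hk' : 54 * M / e ≤ ((k + 1 : ℕ) : ℝ) := hk.trans (by exact_mod_cast Nat.le_succ k)
    rw [div_le_iff₀ he] at hk'
    rw [show 9 * (M * (1 / ((k + 1 : ℕ) : ℝ))) = 9 * M / ((k + 1 : ℕ) : ℝ) by ring, div_le_iff₀ hk1]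
    linarith
  -- level `δ`, transfer rate `h`, stub rate `h'`
  set δ : ℝ := e / 216 with hδ_def
  have hδ : 0 < δ := by positivity
  set h : ℝ := C + 2 with hh_def
  have hCh : C < h := by rw [hh_def]; linarith
  set h' : ℝ := C + 3 with hh'_def
  have hh' : 0 < h' := by rw [hh'_def]; linarith
  -- the lever: fix `η`
  obtain ⟨η₀, hη₀, H3'⟩ := H3 σ hσ hσ3 θ hθpos δ h' hδ hh'
  set η : ℝ := min (η₀ / 2) (1 / 2) with hη_def
  have hη0 : 0 < η := lt_min (by positivity) (by norm_num)
  have hηlt : η < η₀ := lt_of_le_of_lt (min_le_left _ _) (by linarith)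
  have hη1 : η < 1 := lt_of_le_of_lt (min_le_right _ _) (by norm_num)
  have H3'' : ShareLDAt σ θ δ h' η Φ := H3' η hη0 hηlt Φ
  -- the contraction ratio `ρ`
  obtain ⟨ρ, hρ⟩ : ∃ ρ : ℝ, ρ = 1 - η * (1 - η) := ⟨_, rfl⟩
  have hρ0 : 0 < ρ := by rw [hρ]; nlinarith [sq_nonneg η]
  have hρ1 : ρ < 1 := by rw [hρ]; nlinarith [mul_pos hη0 (sub_pos.2 hη1)]
  -- depth `m = j₀ + (n + n₁)`
  obtain ⟨n, hn⟩ := exists_pow_lt_of_lt_one (by positivity : 0 < e / 6 / (9 * 2 ^ j₀)) hρ1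
  obtain ⟨n₁, hn₁⟩ := exists_nat_ge (6 * (36 * M + 18) / e)
  obtain ⟨m, hm_def⟩ : ∃ m : ℕ, m = j₀ + (n + n₁) := ⟨_, rfl⟩
  have hm1 : 1 ≤ m := by omega
  have hmj : m - j₀ = n + n₁ := by omega
  have hmpos : (0 : ℝ) < (m : ℝ) := by exact_mod_cast (show 0 < m by omega)
  have hG : 9 * ((2 : ℝ) ^ j₀ * ρ ^ (n + n₁)) ≤ e / 6 := by
    have h2 : (0 : ℝ) < 9 * 2 ^ j₀ := by positivity
    have hle : ρ ^ (n + n₁) ≤ ρ ^ n := pow_le_pow_of_le_one hρ0.le hρ1.le (Nat.le_add_right n n₁)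
    rw [lt_div_iff₀ h2] at hn
    calc 9 * ((2 : ℝ) ^ j₀ * ρ ^ (n + n₁)) ≤ 9 * ((2 : ℝ) ^ j₀ * ρ ^ n) :=
          mul_le_mul_of_nonneg_left (mul_le_mul_of_nonneg_left hle (by positivity)) (by norm_num)
      _ = ρ ^ n * (9 * 2 ^ j₀) := by ring
      _ ≤ e / 6 := hn.le
  have hm2 : 9 * (M * (4 / (m : ℝ)) + 2 / (m : ℝ)) ≤ e / 6 := by
    have h1 : 6 * (36 * M + 18) / e ≤ (m : ℝ) := hn₁.trans (by exact_mod_cast (show n₁ ≤ m by omega))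
    rw [div_le_iff₀ he] at h1
    rw [show 9 * (M * (4 / (m : ℝ)) + 2 / (m : ℝ)) = (36 * M + 18) / (m : ℝ) by ring, div_le_iff₀ hmpos]
    linarith
  -- the grid (`L = 1`)
  set S : ℕ := 2 * m with hS_def
  have hS : 1 ≤ S := by omega
  have hS2 : 2 ≤ S := by omega
  -- delayed re-merges are rare on this grid
  have hD : ∀ᶠ N : ℕ in atTop,
      ∫⁻ z, ENNReal.ofReal (delayedRemFr σ N ((Φ N).flow (t - Δ N) z) (Δ N) S)
        ∂(localGibbsLaw σ a₀ u₀ θ₀ N (Φ N)) ≤ ENNReal.ofReal (e / 108) :=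
    H4D Δ hΔp hΔ0 hΔg t ht S hS2 (e / 108) (by positivity)
  -- the bad event: some slot has idle fraction or degeneracy score ≥ δ
  set I : (N : ℕ) → ℕ → Set (Cfg N) := fun N r => {y | δ ≤ idleFr σ N y (Δ N) S r} with hI_def
  set D : (N : ℕ) → ℕ → Set (Cfg N) := fun N r => {y | δ ≤ degFr σ N y (Δ N) S r η} with hD_def
  set B : (N : ℕ) → Set (Cfg N) := fun N => ⋃ r ∈ Finset.range S, (I N r ∪ D N r) with hB_def
  have hBc : ∀ N, ∀ y ∉ B N, ∀ r : ℕ, r < 2 * m →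
      idleFr σ N y (Δ N) (2 * m) r < δ ∧ degFr σ N y (Δ N) (2 * m) r η < δ := by
    intro N y hy r hr
    have hr' : r ∈ Finset.range S := Finset.mem_range.2 (hS_def ▸ hr)
    have hy' : y ∉ I N r ∪ D N r := fun hmem => hy (Set.mem_biUnion hr' hmem)
    simp only [hI_def, hD_def, Set.mem_union, Set.mem_setOf_eq, not_or, not_le] at hy'
    exact hy'
  -- G_N(B_N) ≤ e^{-h(N+1)} eventually: union bound over the 2S per-slot events at rate h'
  have hslots : ∀ᶠ N : ℕ in atTop, ∀ r ∈ Finset.range S,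
      eqLaw σ θ N (Φ N) (I N r) ≤ ENNReal.ofReal (Real.exp (-(h' * ((N : ℝ) + 1)))) ∧
      eqLaw σ θ N (Φ N) (D N r) ≤ ENNReal.ofReal (Real.exp (-(h' * ((N : ℝ) + 1)))) := by
    refine (Filter.eventually_all_finset _).2 fun r hr => ?_
    have hr' : r < S := Finset.mem_range.1 hr
    exact (H2 Δ hΔp hΔ0 hΔg S r hS hr' δ h' hδ hh').and (H3'' Δ hΔp hΔ0 hΔg S r hS hr')
  have hGB : ∀ᶠ N : ℕ in atTop,
      eqLaw σ θ N (Φ N) (B N) ≤ ENNReal.ofReal (Real.exp (-(h * ((N : ℝ) + 1)))) := by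
    filter_upwards [hslots, Filter.eventually_ge_atTop (2 * S)] with N hN hN2
    have hsum : eqLaw σ θ N (Φ N) (B N) ≤
        ∑ r ∈ Finset.range S, (ENNReal.ofReal (Real.exp (-(h' * ((N : ℝ) + 1)))) +
          ENNReal.ofReal (Real.exp (-(h' * ((N : ℝ) + 1))))) := by
      calc eqLaw σ θ N (Φ N) (B N)
          ≤ ∑ r ∈ Finset.range S, eqLaw σ θ N (Φ N) (I N r ∪ D N r) := measure_biUnion_finset_le _ _
        _ ≤ ∑ r ∈ Finset.range S, (eqLaw σ θ N (Φ N) (I N r) + eqLaw σ θ N (Φ N) (D N r)) :=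
            Finset.sum_le_sum fun r _ => measure_union_le _ _
        _ ≤ _ := Finset.sum_le_sum fun r hr => add_le_add (hN r hr).1 (hN r hr).2
    refine hsum.trans ?_
    have hx0 : (0 : ℝ) ≤ Real.exp (-(h' * ((N : ℝ) + 1))) := (Real.exp_pos _).le
    rw [← ENNReal.ofReal_add hx0 hx0, Finset.sum_const, Finset.card_range, nsmul_eq_mul,
      ← ENNReal.ofReal_natCast, ← ENNReal.ofReal_mul (Nat.cast_nonneg S)]
    refine ENNReal.ofReal_le_ofReal ?_
    have hn : (2 * S : ℝ) ≤ (N : ℝ) + 1 := by exact_mod_cast (by omega : 2 * S ≤ N + 1)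
    have key := pair_union_rate_le (S := S) (C := C) hn
    rw [hh_def, hh'_def]
    nlinarith [key]
  -- transfer to the evolved law
  have hPB : ∀ᶠ N : ℕ in atTop, localGibbsLaw σ a₀ u₀ θ₀ N (Φ N)
      ((Φ N).flow (t - Δ N) ⁻¹' B N) ≤ ENNReal.ofReal (e / 54) :=
    HT Φ B h hCh hGB (fun N => t - Δ N) (e / 54) (by positivity)
  -- integrate the pathwise dichotomy
  filter_upwards [hPB, hM, hD] with N hN hMN hDN
  set μ : Measure (Cfg N) := localGibbsLaw σ a₀ u₀ θ₀ N (Φ N) with hμ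
  haveI : IsProbabilityMeasure μ := hP N
  have hTm : Measurable ((Φ N).flow (t - Δ N)) := (Φ N).measurable_flow (t - Δ N)
  set T := (Φ N).flow (t - Δ N) with hT
  set B' : Set (Cfg N) := toMeasurable μ (T ⁻¹' B N) with hB'
  have hB'm : MeasurableSet B' := measurableSet_toMeasurable _ _
  have hB'μ : μ B' = μ (T ⁻¹' B N) := measure_toMeasurable _
  have hsub : T ⁻¹' B N ⊆ B' := subset_toMeasurable _ _
  set A : ℝ := 9 * ((2 : ℝ) ^ j₀ * ρ ^ (n + n₁)) + 9 * (2 / (m : ℝ)) + 9 * (2 * (2 * δ)) with hA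
  have hA0 : 0 ≤ A := by positivity
  set c₁ : ℝ := 9 * (1 / (j₀ : ℝ) + 4 / (m : ℝ)) with hc₁
  have hc₁0 : 0 ≤ c₁ := by positivity
  -- pointwise bound of the integrand: constant + two nonnegative functionals + measurable indicator
  have hpt : ∀ z, ENNReal.ofReal (ipr σ N (T z) (Δ N)) ≤
      ((ENNReal.ofReal A + ENNReal.ofReal (c₁ * totalRemFr σ N (T z) (Δ N))) +
        ENNReal.ofReal (18 * delayedRemFr σ N (T z) (Δ N) S)) +
        B'.indicator (fun _ => (9 : ℝ≥0∞)) z := by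
    intro z
    by_cases hz : T z ∈ B N
    · have hz' : z ∈ B' := hsub hz
      rw [Set.indicator_of_mem hz']
      calc ENNReal.ofReal (ipr σ N (T z) (Δ N)) ≤ ENNReal.ofReal 9 :=
            ENNReal.ofReal_le_ofReal (ipr_le_nine (T z) (Δ N))
        _ = 9 := by norm_num
        _ ≤ _ := le_add_self
    · have hb : ∀ r : ℕ, r < 2 * m * 1 →
          idleFr σ N (T z) (Δ N) (2 * m * 1) r + degFr σ N (T z) (Δ N) (2 * m * 1) r η ≤ 2 * δ := by
        intro r hr
        rw [Nat.mul_one] at hr ⊢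
        have h1 := (hBc N (T z) hz r hr).1
        have h2 := (hBc N (T z) hz r hr).2
        linarith
      have hpath := H1 N (T z) (Δ N) (hΔp N) η hη0 hη1 m 1 j₀ hm1 le_rfl hj1 (2 * δ) hb
      simp only [Nat.mul_one] at hpath
      rw [hmj, ← hρ] at hpath
      calc ENNReal.ofReal (ipr σ N (T z) (Δ N))
          ≤ ENNReal.ofReal ((A + c₁ * totalRemFr σ N (T z) (Δ N)) +
              18 * delayedRemFr σ N (T z) (Δ N) S) :=
            ENNReal.ofReal_le_ofReal (by rw [hA, hc₁]; linarith)
        _ ≤ ENNReal.ofReal (A + c₁ * totalRemFr σ N (T z) (Δ N)) +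
              ENNReal.ofReal (18 * delayedRemFr σ N (T z) (Δ N) S) := ENNReal.ofReal_add_le
        _ ≤ (ENNReal.ofReal A + ENNReal.ofReal (c₁ * totalRemFr σ N (T z) (Δ N))) +
              ENNReal.ofReal (18 * delayedRemFr σ N (T z) (Δ N) S) :=
            add_le_add ENNReal.ofReal_add_le le_rfl
        _ ≤ _ := le_self_add
  have hmeas_ind : Measurable (B'.indicator (fun _ => (9 : ℝ≥0∞))) :=
    measurable_const.indicator hB'm
  have hmeas3 : Measurable fun z => ENNReal.ofReal (18 * delayedRemFr σ N (T z) (Δ N) S) :=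
    ENNReal.measurable_ofReal.comp (((H6 N (Δ N) S).comp hTm).const_mul 18)
  -- the four integrals
  have hI1 : ∫⁻ _z, ENNReal.ofReal A ∂μ = ENNReal.ofReal A := by
    rw [lintegral_const, measure_univ, mul_one]
  have hI2 : ∫⁻ z, ENNReal.ofReal (c₁ * totalRemFr σ N (T z) (Δ N)) ∂μ ≤ ENNReal.ofReal (c₁ * M) := by
    calc ∫⁻ z, ENNReal.ofReal (c₁ * totalRemFr σ N (T z) (Δ N)) ∂μ
        = ∫⁻ z, ENNReal.ofReal c₁ * ENNReal.ofReal (totalRemFr σ N (T z) (Δ N)) ∂μ :=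
          lintegral_congr fun z => ENNReal.ofReal_mul hc₁0
      _ = ENNReal.ofReal c₁ * ∫⁻ z, ENNReal.ofReal (totalRemFr σ N (T z) (Δ N)) ∂μ :=
          lintegral_const_mul' _ _ ENNReal.ofReal_ne_top
      _ ≤ ENNReal.ofReal c₁ * ENNReal.ofReal M := mul_le_mul' le_rfl hMN
      _ = ENNReal.ofReal (c₁ * M) := (ENNReal.ofReal_mul hc₁0).symm
  have hI3 : ∫⁻ z, ENNReal.ofReal (18 * delayedRemFr σ N (T z) (Δ N) S) ∂μ ≤ ENNReal.ofReal (e / 6) := by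
    calc ∫⁻ z, ENNReal.ofReal (18 * delayedRemFr σ N (T z) (Δ N) S) ∂μ
        = ∫⁻ z, ENNReal.ofReal 18 * ENNReal.ofReal (delayedRemFr σ N (T z) (Δ N) S) ∂μ :=
          lintegral_congr fun z => ENNReal.ofReal_mul (by norm_num)
      _ = ENNReal.ofReal 18 * ∫⁻ z, ENNReal.ofReal (delayedRemFr σ N (T z) (Δ N) S) ∂μ :=
          lintegral_const_mul' _ _ ENNReal.ofReal_ne_top
      _ ≤ ENNReal.ofReal 18 * ENNReal.ofReal (e / 108) := mul_le_mul' le_rfl hDN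
      _ = ENNReal.ofReal (e / 6) := by
          rw [← ENNReal.ofReal_mul (by norm_num)]
          congr 1
          ring
  have hI4 : ∫⁻ z, B'.indicator (fun _ => (9 : ℝ≥0∞)) z ∂μ ≤ ENNReal.ofReal (e / 6) := by
    rw [lintegral_indicator_const hB'm, hB'μ]
    have h9 : (9 : ℝ≥0∞) = ENNReal.ofReal 9 := by norm_num
    calc (9 : ℝ≥0∞) * μ (T ⁻¹' B N) ≤ 9 * ENNReal.ofReal (e / 54) := mul_le_mul' le_rfl hN
      _ = ENNReal.ofReal (e / 6) := by
          rw [h9, ← ENNReal.ofReal_mul (by norm_num)]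
          congr 1
          ring
  have hδe : 9 * (2 * (2 * δ)) = e / 6 := by rw [hδ_def]; ring
  calc ∫⁻ z, ENNReal.ofReal (ipr σ N (T z) (Δ N)) ∂μ
      ≤ ∫⁻ z, (((ENNReal.ofReal A + ENNReal.ofReal (c₁ * totalRemFr σ N (T z) (Δ N))) +
          ENNReal.ofReal (18 * delayedRemFr σ N (T z) (Δ N) S)) +
          B'.indicator (fun _ => (9 : ℝ≥0∞)) z) ∂μ := lintegral_mono hpt
    _ = ((∫⁻ _z, ENNReal.ofReal A ∂μ + ∫⁻ z, ENNReal.ofReal (c₁ * totalRemFr σ N (T z) (Δ N)) ∂μ) +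
          ∫⁻ z, ENNReal.ofReal (18 * delayedRemFr σ N (T z) (Δ N) S) ∂μ) +
          ∫⁻ z, B'.indicator (fun _ => (9 : ℝ≥0∞)) z ∂μ := by
        rw [lintegral_add_right _ hmeas_ind, lintegral_add_right _ hmeas3, lintegral_add_left measurable_const]
    _ ≤ ((ENNReal.ofReal A + ENNReal.ofReal (c₁ * M)) + ENNReal.ofReal (e / 6)) + ENNReal.ofReal (e / 6) := by
        rw [hI1]
        exact add_le_add (add_le_add (add_le_add le_rfl hI2) hI3) hI4
    _ = ENNReal.ofReal (A + c₁ * M + e / 6 + e / 6) := by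
        have hcM : 0 ≤ c₁ * M := mul_nonneg hc₁0 hM0
        have he6 : 0 ≤ e / 6 := by positivity
        rw [← ENNReal.ofReal_add hA0 hcM, ← ENNReal.ofReal_add (add_nonneg hA0 hcM) he6,
          ← ENNReal.ofReal_add (add_nonneg (add_nonneg hA0 hcM) he6) he6]
    _ ≤ ENNReal.ofReal e := by
        refine ENNReal.ofReal_le_ofReal ?_
        rw [hA, hc₁]
        linarith
    _ = ε := hεe

/-- REGISTERED STUB `stub_cruxCompositionT` of skeleton v8 (the composition at the level of `CruxConclusionAt`; derive it from
`cruxConclusion_pair` with `stub_rowBudgetN`, `fewIdleSuperExp_of_tubeLD ∘ tubeLD_of_stickLD ∘ stub_stickLD`, `shareLDAt_of_nearSetLD`,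
`stub_entropyTransfer`; unfold `PairPath.RemergeBounded` / `DelayedRemergeRare` and combine their σ₀'s by `min`). [folklore] -/
theorem stub_cruxCompositionT : (∀ σ : ℝ, RowBudgetN σ → PairPathBoundT σ) → (∀ σ : ℝ, σ < 1 / 2 → DelayedRemMeasurable σ) → (∃ σ₀ : ℝ, 0 < σ₀ ∧ ∀ σ : ℝ, 0 < σ → σ < σ₀ → ∀ θ : ℝ, 0 < θ → ShareLD.NearSetLD σ θ) → PairPath.RemergeBounded → DelayedRemergeRare → ∀ (a₀ θ₀ : T3 → ℝ) (u₀ : T3 → V3), Continuous a₀ → Continuous θ₀ → Continuous u₀ → (∀ x, 0 < a₀ x) → (∀ x, 0 < θ₀ x) → ∃ σ₀ : ℝ, 0 < σ₀ ∧ ∀ σ : ℝ, 0 < σ → σ < σ₀ → ∀ Φ : (N : ℕ) → Flow σ N, CruxConclusionAt σ a₀ θ₀ u₀ Φ := by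
  intro h₁ h₆ hNear hRem hDel a₀ θ₀ u₀ ha hθ hu ha0 hθ0
  have h₂ : ∀ σ θ : ℝ, 0 < σ → σ < 1 / 2 → 0 < θ → ∀ Φ : (N : ℕ) → Flow σ N, FewIdleSuperExpAt σ θ Φ :=
    fun σ θ h1 h2 h3 =>
      fewIdleSuperExp_of_tubeLD σ θ h1 h2 h3 (tubeLD_of_stickLD σ θ h1 h2 h3 (stub_stickLD σ θ h1 h2 h3))
  have h₃ : ∃ σ₀ : ℝ, 0 < σ₀ ∧ ∀ σ : ℝ, 0 < σ → σ < σ₀ → ∀ θ : ℝ, 0 < θ → ∀ δ h : ℝ, 0 < δ → 0 < h →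
      ∃ η₀ : ℝ, 0 < η₀ ∧ ∀ η : ℝ, 0 < η → η < η₀ → ∀ Φ : (N : ℕ) → Flow σ N, ShareLDAt σ θ δ h η Φ := by
    obtain ⟨σ₀, hσ₀, H⟩ := hNear
    exact ⟨σ₀, hσ₀, fun σ hσ hσlt θ hθ' => shareLDAt_of_nearSetLD σ θ (H σ hσ hσlt θ hθ')⟩
  have h₄ : ∀ (a₀ θ₀ : T3 → ℝ) (u₀ : T3 → V3), Continuous a₀ → Continuous θ₀ → Continuous u₀ →
      (∀ x, 0 < a₀ x) → (∀ x, 0 < θ₀ x) → ∃ σ₀ : ℝ, 0 < σ₀ ∧ ∀ σ : ℝ, 0 < σ → σ < σ₀ →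
      ∀ Φ : (N : ℕ) → Flow σ N, RemergeBoundedAt σ a₀ θ₀ u₀ Φ ∧ DelayedRemergeRareAt σ a₀ θ₀ u₀ Φ := by
    intro a θ' u ha' hθ' hu' ha0' hθ0'
    obtain ⟨σ₁, hσ₁, H₁⟩ := hRem a θ' u ha' hθ' hu' ha0' hθ0'
    obtain ⟨σ₂, hσ₂, H₂⟩ := hDel a θ' u ha' hθ' hu' ha0' hθ0'
    exact ⟨min σ₁ σ₂, lt_min hσ₁ hσ₂, fun σ hσ hσlt Φ =>
      ⟨H₁ σ hσ (lt_of_lt_of_le hσlt (min_le_left _ _)) Φ,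
        H₂ σ hσ (lt_of_lt_of_le hσlt (min_le_right _ _)) Φ⟩⟩
  exact cruxConclusion_pair stub_rowBudgetN h₁ h₂ h₃ h₄ stub_entropyTransfer h₆ a₀ θ₀ u₀ ha hθ hu ha0 hθ0

end

end Summit.AtomisticToContinuum.HydrodynamicLimit.Theorems.DiffuseBackwardInfluenceShare
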